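import Summits.QuantumFields.BalabanUV.T4Continuum.Support.NE7EnergySliceSupFlatSite
import Summits.QuantumFields.BalabanUV.T4Continuum.Support.NE3SmoothLiftCurl
import Summits.QuantumFields.BalabanUV.T4Continuum.Support.NE3CovariantLift
import Summits.QuantumFields.BalabanUV.T4Continuum.Support.NE3FrameFreeDecomposition
import Summits.QuantumFields.BalabanUV.T4Continuum.Support.NE3HodgeCoexactPoincare
import Summits.QuantumFields.BalabanUV.T4Continuum.Support.NE3FramePotBoundW
import Summits.QuantumFields.BalabanUV.T4Continuum.Spine.NE3.CovLiftDivergenceB8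
import HarnessLib

/-!
# NE7FlatSupLetterGeneral — THE FLAT SUP LETTER FOR AN ARBITRARY PERIODIC DIRECTION: `‖Y(y,κ)‖ ≤ M·(K·B + K′·D) + K″·w∕M` from the curl bound `B`, the distance `D` of the
# flat divergence from `M`-block constants, and the straight datum `w ≥ ‖QbarIter L (k+1) 1 Y‖` (`M = L^{k+1}`; `K, K′, K″` functions of `d`, `card n` only)

Cell `pub-balaban`, rung (B)+1 sub-cell t4, lineage `b2b-balaban-t4-ne7-p1`, generation 101 (CRUX PROVER NE7 #1 = OWNER of BINDER row NE7).  Memo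
`t4/b2b-balaban-t4-ne7-p1-g101/ROAD-G101.md` §1: THE ENGINE OF THE LOCAL BOOTSTRAP for the curved sup letter (L) (memo ROAD-G100 §4) in the form the assembly consumes — the
cut-off, gauged, periodized copy of a curved slice element has NONE of the three slice data exactly zero, only small: this file removes the straight datum by row NE3's SMOOTH
LIFT (the exact right inverse of the iterated straight average, `NE3SmoothLiftFlat.linQ_smoothLift`), whose sup, flat curl and flat divergence are `O(w∕M)`, `O(w∕M²)`, `O(w∕M²)`
per coarse value (`NE3SmoothLiftBounds.norm_smoothLift_le`, `NE3SmoothLiftCurl.norm_curlAt_flat_smoothLift_le`, `Spine/NE3/CovLiftDivergenceB8.norm_covDiv_covLift_le` at `W = 1`),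
and hands the tangent remainder to gen 101's `NE7EnergySliceSupFlatSite.sup_flat_of_QbarIter` (general divergence).
WHAT ([folklore]; 0 def, 0 sorry; dimension `d + 1`, `L ≥ 2`, every `k`, every `N ≥ 1`).  §1 `QbarIter_flat_smoothLift` (exact right inverse), `flatDiv_smoothLift_le`.
§2 **`sup_flat_general`**: `∃ K K′ K″ > 0` such that for every `(L^{k+1}N)`-periodic `Y`, every `B ≥ 0` bounding `‖curlAt 1 Y z μ ν‖` (`μ ≠ ν`), every coarse `c` and `D` with
`‖flatDiv Y x − c(blk_M x)‖ ≤ D`, and every `w` with `‖QbarIter L (k+1) 1 Y z κ‖ ≤ w`: `‖Y y κ‖ ≤ L^{k+1}·(K·B + K′·D) + K″·w∕L^{k+1}`.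
HONEST FRAMING (page 1): `U = 1`, linear; constants existential through GAN24's letters; THE CURVED LETTER (L) IS NOT PROVED HERE (engine only); NOT (S1), NOT NE7; spine 0∕9; finite
T⁴ rung (B)+1 — NOT infinite volume, NOT mass gap, NOT BetaPertH, NOT Clay.  Continuum YM on T⁴ ⇐ BetaPertH ∧ nine spine estimates (0/9 proved); BetaPertH ⇐ (D1) ∧ (D4) ∧
CAP+tail; G-an2-4 gates asym, D1 and NE2/3/4.
-/

set_option autoImplicit false

open scoped BigOperators Matrix.Norms.L2Operator
open Finset

namespace Summit.QuantumFields.BalabanUV.T4Continuum.NE7FlatSupLetterGeneral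

open Literature.MathematicalPhysics.QuantumFieldTheory.Balaban1983to89
open B7Prop1Explicit (Site e e_apply)
open T4AveragingDeficitWall (IsUnitaryCfg curlAt)
open AveragingDeficitPeriodicCounting (IsPeriodicDir)
open BlockAveragePushDirSplit (flat)
open MinimalActionWitness (flatCfg)
open NE3TangentFlatPush (flatCfg_eq_flat)
open NE3FlatHessianCurl (isUnitaryCfg_flatCfg smallField_flatCfg_zero)
open NE3CoercivityScaling (flatDiv)
open NE3CovariantWeitzenbock (covDiv)
open NE3FrameFreeSliceUnique (covDiv_flatCfg_eq_flatDiv)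
open NE3FrameFreeDecomposition (flatDiv_sub)
open NE3TangentCovariantTower (QbarIter QbarIter_flat)
open NE3SmoothRightInverseFlat (iterate_Qcoarse_apply)
open NE3HodgeCoexactPoincare (iterate_Qcoarse_sub)
open NE3SmoothLiftFlat (smoothLift linQ_smoothLift)
open NE3SmoothLiftBounds (norm_smoothLift_le)
open NE3SmoothRightInverseBounds (smoothLift_add_period)
open NE3SmoothLiftCurl (norm_curlAt_flat_smoothLift_le curlAt_flat_eq)
open NE3CovariantLift (covLift_flat)
open NE3QbarIterCovLiftPrep (liftC)
open NE3.CovLiftDivergenceB8 (norm_covDiv_covLift_le)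
open NE3FramePotBoundW (isPeriodicDir_QbarIter)
open NE7CornerSpikeTopDictionary (natCast_tower_eq_pow_mul)
open MinimalActionWitness (isPeriodicCfg_flatCfg)
open SmoothRefineBlocks (blk)
open NE7EnergySliceSupFlatSite (sup_flat_of_QbarIter)

noncomputable section

variable {d : ℕ} {n : Type*} [Fintype n] [DecidableEq n]

/-! ## §1 The smooth lift: exact right inverse of the iterated flat average; its flat divergence -/

/-- **`QbarIter L (k+1) 1 (smoothLift L^{k+1} φ) = φ`** (`L ≥ 2`): the smooth lift is an exact right inverse of the iterated flat block average. [folklore] -/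
theorem QbarIter_flat_smoothLift {L : ℕ} (hL : 2 ≤ L) (k : ℕ) (φ : Site d → Fin d → Matrix n n ℂ) (z : Site d) (κ : Fin d) :
    QbarIter L (k + 1) (flat (d := d) (n := n)) (smoothLift (L ^ (k + 1)) φ) z κ = φ z κ := by
  have hL1 : 1 ≤ L := by omega
  have hM2 : 2 ≤ L ^ (k + 1) := le_trans hL (by
    calc L = L ^ 1 := (pow_one L).symm
      _ ≤ L ^ (k + 1) := Nat.pow_le_pow_right (by omega) (by omega))
  rw [QbarIter_flat hL1 (k + 1), iterate_Qcoarse_apply, linQ_smoothLift hM2]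

/-- **THE FLAT DIVERGENCE OF THE SMOOTH LIFT IS `O(w∕M²)`**: `‖flatDiv (smoothLift M φ) x‖ ≤ liftC·(6∕M²)·d·w` when `‖φ‖ ≤ w` (row NE3's covariant divergence letter of the
covariant lift at `W = 1`). [folklore] -/
theorem flatDiv_smoothLift_le [Nonempty n] {M : ℕ} (hM : 2 ≤ M) (φ : Site d → Fin d → Matrix n n ℂ) {w : ℝ} (hw : ∀ z κ, ‖φ z κ‖ ≤ w) (x : Site d) :
    ‖flatDiv (smoothLift M φ) x‖ ≤ liftC d * (6 / (M : ℝ) ^ 2) * (d * w) := by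
  have h := norm_covDiv_covLift_le hM (isUnitaryCfg_flatCfg (d := d) (n := n)) le_rfl smallField_flatCfg_zero φ x
  rw [covDiv_flatCfg_eq_flatDiv, flatCfg_eq_flat, covLift_flat] at h
  refine h.trans ?_
  have hsum : ∑ μ : Fin d, ‖φ (blk M (x - e μ)) μ‖ ≤ d * w := by
    calc ∑ μ : Fin d, ‖φ (blk M (x - e μ)) μ‖ ≤ ∑ _μ : Fin d, w := Finset.sum_le_sum fun μ _ => hw _ _
      _ = d * w := by rw [Finset.sum_const, Finset.card_univ, Fintype.card_fin, nsmul_eq_mul]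
  have hc : 0 ≤ liftC d * (6 / (M : ℝ) ^ 2 + 2 * ((d : ℝ) + 1) * 0) := by unfold liftC; positivity
  calc liftC d * (6 / (M : ℝ) ^ 2 + 2 * ((d : ℝ) + 1) * 0) * ∑ μ : Fin d, ‖φ (blk M (x - e μ)) μ‖
      ≤ liftC d * (6 / (M : ℝ) ^ 2 + 2 * ((d : ℝ) + 1) * 0) * (d * w) := mul_le_mul_of_nonneg_left hsum hc
    _ = liftC d * (6 / (M : ℝ) ^ 2) * (d * w) := by ring

/-! ## §2 The general flat sup letter -/

/-- **THE FLAT SUP LETTER FOR AN ARBITRARY PERIODIC DIRECTION** (dimension `d + 1`, `L ≥ 2`, every `k`, every `N ≥ 1`): `∃ K K′ K″ > 0` (functions of `d`, `card n`) such that for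
every `(L^{k+1}N)`-periodic `Y`, every `B ≥ 0` with `‖curlAt 1 Y z μ ν‖ ≤ B` off the diagonal, every coarse `c` and `D` with `‖flatDiv Y x − c (blk_{L^{k+1}} x)‖ ≤ D`, and every `w`
with `‖QbarIter L (k+1) 1 Y z κ‖ ≤ w`: `‖Y y κ‖ ≤ L^{k+1}·(K·B + K′·D) + K″·w∕L^{k+1}`.  (`w = 0`: `NE7EnergySliceSupFlatSite.sup_flat_of_QbarIter`; `w = D = 0`: the energy slice.)
[folklore] -/
theorem sup_flat_general [Nonempty n] :
    ∃ K : ℝ, 0 < K ∧ ∃ K' : ℝ, 0 < K' ∧ ∃ K'' : ℝ, 0 < K'' ∧ ∀ (L : ℕ), 2 ≤ L → ∀ (k N : ℕ) [NeZero N]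
      (Y : Site (d + 1) → Fin (d + 1) → Matrix n n ℂ), IsPeriodicDir Y ((L ^ (k + 1) * N : ℕ) : ℤ) →
      ∀ (B : ℝ), 0 ≤ B → (∀ (z : Site (d + 1)) (μ ν : Fin (d + 1)), μ ≠ ν → ‖curlAt (flat (d := d + 1) (n := n)) Y z μ ν‖ ≤ B) →
      ∀ (c : Site (d + 1) → Matrix n n ℂ) (D : ℝ), (∀ x, ‖flatDiv Y x - c (blk (L ^ (k + 1)) x)‖ ≤ D) →
      ∀ (w : ℝ), (∀ (z : Site (d + 1)) (κ : Fin (d + 1)), ‖QbarIter L (k + 1) (flat (d := d + 1) (n := n)) Y z κ‖ ≤ w) →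
      ∀ (y : Site (d + 1)) (κ : Fin (d + 1)),
        ‖Y y κ‖ ≤ (L : ℝ) ^ (k + 1) * (K * B + K' * D) + K'' * w / (L : ℝ) ^ (k + 1) := by
  obtain ⟨K, hK, K', hK', h⟩ := sup_flat_of_QbarIter (d := d) (n := n)
  -- the lift constants
  set cL : ℝ := 24 * (8 : ℝ) ^ ((d + 1) - 1) with hcL
  have hcL0 : 0 < cL := by positivity
  have hliftC : 0 < liftC (d + 1) := by unfold liftC; positivity
  refine ⟨K, hK, K', hK', K * (2 * cL) + K' * (liftC (d + 1) * 6 * (d + 1)) + cL, by positivity,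
    fun L hL k N _ Y hYP B hB0 hB c D hD w hw y κ => ?_⟩
  have hL1 : 1 ≤ L := by omega
  have hM2 : 2 ≤ L ^ (k + 1) := le_trans hL (by
    calc L = L ^ 1 := (pow_one L).symm
      _ ≤ L ^ (k + 1) := Nat.pow_le_pow_right (by omega) (by omega))
  have hM1 : 1 ≤ L ^ (k + 1) := by omega
  have hd1 : 1 ≤ d + 1 := by omega
  have hMr : ((L ^ (k + 1) : ℕ) : ℝ) = (L : ℝ) ^ (k + 1) := by push_cast; ring
  have hM0 : (0 : ℝ) < (L : ℝ) ^ (k + 1) := by rw [← hMr]; exact_mod_cast (by omega : 0 < L ^ (k + 1))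
  have hw0 : 0 ≤ w := (norm_nonneg _).trans (hw 0 ⟨0, hd1⟩)
  have hD0 : 0 ≤ D := (norm_nonneg _).trans (hD 0)
  -- the straight datum and its lift
  set φ := QbarIter L (k + 1) (flat (d := d + 1) (n := n)) Y with hφ
  have hφP : IsPeriodicDir φ (N : ℤ) := by
    have hYP' : IsPeriodicDir Y ((AveragingDeficitMultiLevelPrep.tower L N (k + 1) : ℕ) : ℤ) := by rw [natCast_tower_eq_pow_mul]; exact hYP
    exact isPeriodicDir_QbarIter L N (k + 1) (by rw [← flatCfg_eq_flat]; exact isPeriodicCfg_flatCfg _) hYP'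
  set R := smoothLift (L ^ (k + 1)) φ with hR
  set X : Site (d + 1) → Fin (d + 1) → Matrix n n ℂ := fun y κ => Y y κ - R y κ with hX
  -- `X` is periodic and tangent
  have hRP : IsPeriodicDir R ((L ^ (k + 1) * N : ℕ) : ℤ) := fun x τ κ => smoothLift_add_period hM1 (fun z τ' κ' => hφP z τ' κ') x τ κ
  have hXP : IsPeriodicDir X ((L ^ (k + 1) * N : ℕ) : ℤ) := fun x τ κ => by
    simp only [hX]; rw [hYP x τ κ, hRP x τ κ]
  have hXQ : QbarIter L (k + 1) (flat (d := d + 1) (n := n)) X = 0 := by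
    funext z κ'
    rw [hX, QbarIter_flat hL1 (k + 1), iterate_Qcoarse_sub, Pi.zero_apply, Pi.zero_apply]
    dsimp only
    rw [← QbarIter_flat hL1 (k + 1), ← QbarIter_flat hL1 (k + 1), hR, QbarIter_flat_smoothLift hL k, ← hφ, sub_self]
  -- the curl of `X`
  have hRb : ∀ z κ', ‖R z κ'‖ ≤ cL / (L : ℝ) ^ (k + 1) * w := fun z κ' => by
    have h1 := norm_smoothLift_le hM2 hd1 φ z κ'
    rw [hMr] at h1
    exact h1.trans (mul_le_mul_of_nonneg_left (hw _ _) (by positivity))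
  have hXcurl : ∀ (z : Site (d + 1)) (μ ν : Fin (d + 1)), μ ≠ ν →
      ‖curlAt (flat (d := d + 1) (n := n)) X z μ ν‖ ≤ B + cL / ((L : ℝ) ^ (k + 1)) ^ 2 * (2 * w) := by
    intro z μ ν hμν
    have e1 : curlAt (flat (d := d + 1) (n := n)) X z μ ν
        = curlAt (flat (d := d + 1) (n := n)) Y z μ ν - curlAt (flat (d := d + 1) (n := n)) R z μ ν := by
      simp only [hX, curlAt_flat_eq]; abel
    rw [e1]
    refine (norm_sub_le _ _).trans (add_le_add (hB z μ ν hμν) ?_)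
    have h2 := norm_curlAt_flat_smoothLift_le hM2 hd1 φ z hμν
    rw [hMr] at h2
    refine h2.trans ?_
    have : ‖φ (blk (L ^ (k + 1)) z) ν‖ + ‖φ (blk (L ^ (k + 1)) z) μ‖ ≤ 2 * w := by linarith [hw (blk (L ^ (k + 1)) z) ν, hw (blk (L ^ (k + 1)) z) μ]
    exact mul_le_mul_of_nonneg_left this (by positivity)
  -- the divergence of `X`
  have hXdiv : ∀ x, ‖flatDiv X x - c (blk (L ^ (k + 1)) x)‖ ≤ D + liftC (d + 1) * (6 / ((L : ℝ) ^ (k + 1)) ^ 2) * ((d + 1 : ℕ) * w) := by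
    intro x
    have e1 : flatDiv X x = flatDiv Y x - flatDiv R x := flatDiv_sub Y R x
    rw [e1, show flatDiv Y x - flatDiv R x - c (blk (L ^ (k + 1)) x) = (flatDiv Y x - c (blk (L ^ (k + 1)) x)) - flatDiv R x by abel]
    refine (norm_sub_le _ _).trans (add_le_add (hD x) ?_)
    have h3 := flatDiv_smoothLift_le (d := d + 1) hM2 φ hw x
    rw [hMr] at h3
    exact h3
  -- the tangent letter for `X`
  have hB' : 0 ≤ B + cL / ((L : ℝ) ^ (k + 1)) ^ 2 * (2 * w) := by positivity
  have key := h L hL1 k N X hXP hXQ _ hB' hXcurl c _ hXdiv y κ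
  -- sum
  have hYX : Y y κ = X y κ + R y κ := by simp only [hX]; abel
  rw [hYX]
  refine (norm_add_le _ _).trans ((add_le_add key (hRb y κ)).trans (le_of_eq ?_))
  push_cast
  field_simp
  ring

end

end Summit.QuantumFields.BalabanUV.T4Continuum.NE7FlatSupLetterGeneral
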